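import Literature.NumberTheory.Automorphic.GKModuleRing
import HarnessLib

/-!
# Products of `(𝔤, K)`-modules over the operator ring: `M × N` is a `(𝔤, K)`-module

Family `hodge`, lane `lit-hodgefound` (foundations library; seat `lit-hodgefound-p39`, generation 29, row g29-#14); topic
`NumberTheory/Automorphic` (next to `GKModuleRing`), namespace `Literature.NumberTheory.Automorphic.GKRing`.  For two `GKRing G`-modules
`M`, `N` (with `IsScalarTower ℂ`) Mathlib's product `M × N` is again a `GKRing G`-module with `IsScalarTower ℂ` (instances `Prod.module`,
`Prod.isScalarTower`), and the `(𝔤, K)`-data it CARRIES (`GKRing.actK`, `GKRing.actLie`, §3 of `GKModuleRing`) is the componentwise data: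
`actK G (M × N) k (m, n) = (actK G M k m, actK G N k n)` (`actK_prod_apply`, by `rfl`).  **`isGKModule_prod`**: if `M` and `N` satisfy the
`(𝔤, K)`-module axioms (`IsGKModule`: every vector `K`-finite, `K` weakly continuous, `Ad`-compatibility, weak derivative along `𝔨`) then so
does `M × N` — the direct sum of two `(𝔤, K)`-modules is a `(𝔤, K)`-module («The category `𝒞(𝔤, K)` … is closed under passage to
submodules, quotients, and finite direct sums», Knapp–Vogan after (1.87); Borel–Wallach 0 §2.5).  The orbit span of `(m, n)` lies in the image of
`span(K·m) × span(K·n)`; matrix coefficients and weak derivatives of `M × N` are sums of those of `M` and `N` for the functionals `ℓ ∘ inl`,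
`ℓ ∘ inr`.  With this, functors on `(𝔤, K)`-modules over the operator ring can be evaluated on binary products (e.g. `ψ(X ⊕ Y)` for the
translation functors of `BorelWallach2000/U11Translation*`).  Theorems only; 0 `sorry`, no named fact (net debt 0, D-0026).

## The sources, verbatim

* A. W. Knapp, D. A. Vogan, *Cohomological Induction and Unitary Representations* (1995) [KnappVogan1995], §I.6 after (1.87): the category
  `𝒞(𝔤, K)` of `(𝔤, K)`-modules; Thm. 1.117 (b)–(d): `(𝔤, K)`-modules as unital `R(𝔤, K)`-modules, `(𝔤, K)`-maps as `R`-linear maps.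
* A. Borel, N. Wallach, *Continuous Cohomology, Discrete Subgroups, and Representations of Reductive Groups*, 2nd ed. (2000) [BorelWallach2000],
  0 §2.5 (the axioms of a `(𝔤, K)`-module), I §2.2.

## What is formalised

`actK_prod_apply`, `actLie_prod_apply`, `fst_comp_actK`, `snd_comp_actK` (componentwise data, `rfl`), `dual_prod_apply` (`ℓ(m, n) = ℓ(m, 0) + ℓ(0, n)`),
**`isGKModule_prod`**, and the projections/injections as `(𝔤, K)`-maps are Mathlib's `LinearMap.fst/snd/inl/inr` over `GKRing G` (nothing to
define).  NOT here: infinite direct sums; products of primary components / translation functors (the `U(1,1)` files).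

## References

* A. W. Knapp, D. A. Vogan, *Cohomological Induction and Unitary Representations*, Princeton Math. Ser. 45 (1995), §I.6 (1.87) ff., Thm. 1.117.
  [KnappVogan1995]
* A. Borel, N. Wallach, *Continuous Cohomology, Discrete Subgroups, and Representations of Reductive Groups*, 2nd ed., AMS (2000), 0 §2.5, I §2.2.
  [BorelWallach2000]
-/

noncomputable section

namespace Literature.NumberTheory.Automorphic

open Module

variable {A : Type*} [NormedCommRing A] [NormedAlgebra ℝ A] [NormedAlgebra ℚ A] [CompleteSpace A]
  [StarRing A] {N : Type*} [Fintype N] [DecidableEq N] (G : RealMatrixGroup A N)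

-- Mathlib idiom (as in `GKModules`, `GKModuleRing`): commutator bracket on `Module.End` / matrices
attribute [local instance 100] LieRing.ofAssociativeRing

namespace GKRing

section Prod

set_option maxSynthPendingDepth 4

variable (M P : Type*) [AddCommGroup M] [Module ℂ M] [Module (GKRing G) M] [IsScalarTower ℂ (GKRing G) M]
  [AddCommGroup P] [Module ℂ P] [Module (GKRing G) P] [IsScalarTower ℂ (GKRing G) P]

/-- The carried `K`-action of `M × P` is componentwise: `[k] • (m, p) = ([k] • m, [k] • p)`. [cite: KnappVogan1995, Thm. 1.117 (c)] -/
@[simp] theorem actK_prod_apply (k : G.maximalCompact) (x : M × P) :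
    actK G (M × P) k x = (actK G M k x.1, actK G P k x.2) := rfl

/-- The carried `𝔤`-action of `M × P` is componentwise. [cite: KnappVogan1995, Thm. 1.117 (c)] -/
@[simp] theorem actLie_prod_apply (X : G.lie) (x : M × P) :
    actLie G (M × P) X x = (actLie G M X x.1, actLie G P X x.2) := rfl

/-- A functional on `M × P` splits along `inl`, `inr`: `ℓ(m, p) = (ℓ ∘ inl)(m) + (ℓ ∘ inr)(p)`. [cite: KnappVogan1995, §I.6] -/
theorem dual_prod_apply (ℓ : Module.Dual ℂ (M × P)) (x : M × P) :
    ℓ x = (ℓ ∘ₗ LinearMap.inl ℂ M P) x.1 + (ℓ ∘ₗ LinearMap.inr ℂ M P) x.2 := by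
  rw [LinearMap.comp_apply, LinearMap.comp_apply, ← map_add, LinearMap.inl_apply, LinearMap.inr_apply, Prod.mk_add_mk, add_zero, zero_add]

variable [StarModule ℝ A] [ContinuousStar A]

/-- **The product `M × P` of two `(𝔤, K)`-modules over the operator ring is a `(𝔤, K)`-module** (finite direct sums stay in `𝒞(𝔤, K)`):
`K`-finiteness (the orbit span of `(m, p)` lies in the image of `span(K·m) × span(K·p)` under `inl + inr`), weak continuity and the weak
derivative along `𝔨` (sums of the matrix coefficients for `ℓ ∘ inl`, `ℓ ∘ inr`), `Ad`-compatibility (componentwise).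
[cite: KnappVogan1995, §I.6 after (1.87), Thm. 1.117 (d)] [cite: BorelWallach2000, 0 §2.5, I §2.2] -/
theorem isGKModule_prod (hM : IsGKModule G (actK G M) (actLie G M)) (hP : IsGKModule G (actK G P) (actLie G P)) :
    IsGKModule G (actK G (M × P)) (actLie G (M × P)) where
  kFinite x := by
    haveI := hM.kFinite x.1
    haveI := hP.kFinite x.2
    -- the orbit span lies in the range of `span(K·m) × span(K·p) → M × P`
    let SM := Submodule.span ℂ (Set.range fun k : G.maximalCompact ↦ actK G M k x.1)
    let SP := Submodule.span ℂ (Set.range fun k : G.maximalCompact ↦ actK G P k x.2)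
    have hle : Submodule.span ℂ (Set.range fun k : G.maximalCompact ↦ actK G (M × P) k x) ≤
        LinearMap.range (SM.subtype.prodMap SP.subtype) := by
      refine Submodule.span_le.mpr (Set.range_subset_iff.mpr fun k => ?_)
      exact ⟨(⟨actK G M k x.1, Submodule.subset_span ⟨k, rfl⟩⟩, ⟨actK G P k x.2, Submodule.subset_span ⟨k, rfl⟩⟩), rfl⟩
    exact Submodule.finiteDimensional_of_le hle
  weaklyContinuous x ℓ := by
    have key : (fun k : G.maximalCompact ↦ ℓ (actK G (M × P) k x)) = fun k ↦
        (ℓ ∘ₗ LinearMap.inl ℂ M P) (actK G M k x.1) + (ℓ ∘ₗ LinearMap.inr ℂ M P) (actK G P k x.2) := by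
      funext k
      exact dual_prod_apply M P ℓ _
    rw [key]
    exact (hM.weaklyContinuous x.1 _).add (hP.weaklyContinuous x.2 _)
  ad_compat k X := by
    refine LinearMap.ext fun x => Prod.ext ?_ ?_
    · exact LinearMap.congr_fun (hM.ad_compat k X) x.1
    · exact LinearMap.congr_fun (hP.ad_compat k X) x.2
  hasWeakDeriv X x ℓ := by
    have key : (fun t : ℝ ↦ ℓ (actK G (M × P) (G.expK (t • X)) x)) = fun t ↦
        (ℓ ∘ₗ LinearMap.inl ℂ M P) (actK G M (G.expK (t • X)) x.1) + (ℓ ∘ₗ LinearMap.inr ℂ M P) (actK G P (G.expK (t • X)) x.2) := by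
      funext t
      exact dual_prod_apply M P ℓ _
    rw [key, dual_prod_apply M P ℓ (actLie G (M × P) (LieSubalgebra.inclusion G.compactLie_le_lie X) x)]
    exact (hM.hasWeakDeriv X x.1 _).add (hP.hasWeakDeriv X x.2 _)

end Prod

end GKRing

end Literature.NumberTheory.Automorphic
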